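import Summits.QuantumAdvantage.AdviceFreeQNC0.FibreDecimation37ParityCount
import HarnessLib

/-!
# Cell qa-qnc0, `p = 3` — ROUND-38P2 Lemma 38.C (the MIXED-NORM third step): short relations by their `L¹` mass, long relations by
# Parseval / Cauchy–Schwarz; the parity-class count under (NH_{s₀})

Planner qa-qnc0-p2 g38, ROUND-38P2 §1.3 / Lemma 38.C (corrected form `NHsE`, custody file `SubRowDecimation38C.lean`, after P3-24b): the
decoded tests split into the GENUINE ones (index set `J`; `|a_{k,0}| = 1/3`, `|a_{k,±}| = 2/3`) and TRIVIAL ones (`A_k ∈ {∅, ℤ/3}`, `|a_{k,0}| = 1`).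
Then

* **`sum_short_eq_shortMass`** — the `L¹` mass of the coefficients of the patterns of support `≤ s₀` is EXACTLY
  `S(|J|,s₀) = 3^{−|J|} Σ_{t ≤ s₀} C(|J|,t) 4^t` (generating polynomial `Σ_s c_s X^{wt s} = (1/3 + (4/3)X)^{|J|}`, coefficient extraction);
* **`card_parityClass_filter_le_mixed`** — on the parity class `{u : |u| ≡ p}` (`ι ≠ ∅`) the parity of the number of firing tests is prescribed on
  at most `(7/8)·2^{|ι|−1}` points, PROVIDED `S(|J|,s₀) ≤ 1/10` (short relations "free") and `Σ_{|supp s| > s₀, supp s ⊆ J}(3/4)^{wt λ(s)} ≤ 1/100`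
  (long relations not `3/4`-heavy): `|T₀|, |T₁| ≤ 2^n(S + √(Σ|ĉ|²·1/100)) ≤ 2^n·(1/5)`, so the signed class count is `≤ (1/5)·2^{|ι|−1}·2`… `≤ (7/8)`.

The cell's statement (planner p2 g38); standard character-sum bookkeeping.  WHAT THIS IS NOT: nothing about the game; Theorem 38.F is the sequel.
-/

noncomputable section

namespace Summit.QuantumAdvantage.AdviceFreeQNC0.Exp37

open Finset ZMod Polynomial
open Literature.Computability.MetaComplexity Literature.Computability.MetaComplexity.ModTestProduct
open Literature.Computability.MetaComplexity.TwoModuli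

section Mixed

variable {ι : Type*} [Fintype ι] [DecidableEq ι] {κ : Type*} [Fintype κ] [DecidableEq κ]

/-! ### The short mass: generating polynomial and coefficient extraction -/

omit [Fintype ι] [DecidableEq ι] [Fintype κ] [DecidableEq κ] in
/-- Per-test generating factor: `Σ_v ‖a_v‖ X^{[v ≠ 0]}` is `C(1/3) + C(4/3)X` for a genuine test and `1` for a trivial one. -/
theorem sum_norm_fcoef_mul_X (A : Finset (ZMod 3)) :
    (∑ v : ZMod 3, Polynomial.C (‖fcoef (signTest A) v‖) * (if v ≠ 0 then (X : ℝ[X]) else 1)) =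
      if (A.Nonempty ∧ A ≠ univ) then Polynomial.C (1 / 3 : ℝ) + Polynomial.C (4 / 3 : ℝ) * X else 1 := by
  rw [show (∑ v : ZMod 3, Polynomial.C (‖fcoef (signTest A) v‖) * (if v ≠ 0 then (X : ℝ[X]) else 1)) =
      Polynomial.C (‖fcoef (signTest A) 0‖) * (if (0 : ZMod 3) ≠ 0 then (X : ℝ[X]) else 1) +
      Polynomial.C (‖fcoef (signTest A) 1‖) * (if (1 : ZMod 3) ≠ 0 then (X : ℝ[X]) else 1) +
      Polynomial.C (‖fcoef (signTest A) 2‖) * (if (2 : ZMod 3) ≠ 0 then (X : ℝ[X]) else 1) from Fin.sum_univ_three _]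
  simp only [ne_eq, not_true_eq_false, if_false, mul_one]
  rw [if_pos (by decide : ¬ (1 : ZMod 3) = 0), if_pos (by decide : ¬ (2 : ZMod 3) = 0)]
  by_cases h : A.Nonempty ∧ A ≠ univ
  · rw [if_pos h, fcoef_sign_norm_zero _ (signTest_sign' A) (signTest_nonconst' h.1 h.2),
      fcoef_sign_norm_ne_zero _ (signTest_sign' A) (signTest_nonconst' h.1 h.2) (by decide),
      fcoef_sign_norm_ne_zero _ (signTest_sign' A) (signTest_nonconst' h.1 h.2) (by decide)]
    have h43 : (2 / 3 : ℝ) + 2 / 3 = 4 / 3 := by norm_num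
    rw [add_assoc, ← add_mul, ← Polynomial.C_add, h43]
  · rw [if_neg h]
    obtain ⟨c, hc, hA⟩ := signTest_const_of h
    rw [hA, fcoef_const, fcoef_const, fcoef_const, if_pos rfl, if_neg (by decide), if_neg (by decide), norm_zero,
      Polynomial.C_0, zero_mul, add_zero, add_zero]
    have : ‖c‖ = 1 := by rcases hc with rfl | rfl <;> simp
    rw [this, Polynomial.C_1]

omit [Fintype ι] [DecidableEq ι] in
/-- **Generating polynomial of the coefficient masses**: `Σ_s (∏_k ‖a_{k,s_k}‖) X^{wt s} = (1/3 + (4/3)X)^{|J|}` when the tests in `J`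
are genuine and the others trivial. -/
theorem genPoly_eq (A : κ → Finset (ZMod 3)) (J : Finset κ) (hgen : ∀ k ∈ J, (A k).Nonempty ∧ A k ≠ univ)
    (htriv : ∀ k, k ∉ J → ¬ ((A k).Nonempty ∧ A k ≠ univ)) :
    (∑ s : κ → ZMod 3, Polynomial.C (∏ k, ‖fcoef (signTest (A k)) (s k)‖) * (X : ℝ[X]) ^ wt s) =
      (Polynomial.C (1 / 3 : ℝ) + Polynomial.C (4 / 3 : ℝ) * X) ^ J.card := by
  classical
  have hterm : ∀ s : κ → ZMod 3, Polynomial.C (∏ k, ‖fcoef (signTest (A k)) (s k)‖) * (X : ℝ[X]) ^ wt s =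
      ∏ k, (fun (k : κ) (v : ZMod 3) => Polynomial.C (‖fcoef (signTest (A k)) v‖) * (if v ≠ 0 then (X : ℝ[X]) else 1)) k (s k) := by
    intro s
    symm
    rw [prod_mul_distrib, ← map_prod Polynomial.C (fun k => ‖fcoef (signTest (A k)) (s k)‖) univ, prod_ite, prod_const_one,
      mul_one, prod_const]
    rfl
  simp_rw [hterm]
  rw [← Fintype.prod_sum (fun (k : κ) (v : ZMod 3) =>
    Polynomial.C (‖fcoef (signTest (A k)) v‖) * (if v ≠ 0 then (X : ℝ[X]) else 1))]
  rw [Finset.prod_congr rfl fun k _ => sum_norm_fcoef_mul_X (A k)]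
  rw [prod_ite, prod_const, prod_const_one, mul_one]
  have h1 : (univ.filter fun k => (A k).Nonempty ∧ A k ≠ univ) = J := by
    ext k; simp only [mem_filter, mem_univ, true_and]
    exact ⟨fun h => by_contra fun hk => htriv k hk h, fun h => hgen k h⟩
  rw [h1]

omit [Fintype ι] [DecidableEq ι] in
/-- **Coefficient extraction**: the mass of the patterns of weight exactly `t` is `3^{−|J|}·C(|J|,t)·4^t`. -/
theorem sum_wt_eq (A : κ → Finset (ZMod 3)) (J : Finset κ) (hgen : ∀ k ∈ J, (A k).Nonempty ∧ A k ≠ univ)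
    (htriv : ∀ k, k ∉ J → ¬ ((A k).Nonempty ∧ A k ≠ univ)) (t : ℕ) :
    ∑ s ∈ (univ : Finset (κ → ZMod 3)).filter (fun s => wt s = t), ∏ k, ‖fcoef (signTest (A k)) (s k)‖ =
      (3 : ℝ)⁻¹ ^ J.card * (((J.card.choose t : ℕ) : ℝ) * 4 ^ t) := by
  classical
  have h := congrArg (fun P : ℝ[X] => P.coeff t) (genPoly_eq A J hgen htriv)
  simp only [finsetSum_coeff, coeff_C_mul_X_pow] at h
  rw [← Finset.sum_filter] at h
  rw [show (univ.filter fun s : κ → ZMod 3 => wt s = t) = univ.filter fun s => t = wt s from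
    filter_congr fun s _ => eq_comm, h]
  -- the binomial coefficient of `(C a + C b X)^n`
  rw [add_comm, add_pow, finsetSum_coeff]
  have hcoef : ∀ m ∈ range (J.card + 1), ((Polynomial.C (4 / 3 : ℝ) * X) ^ m * Polynomial.C (1 / 3 : ℝ) ^ (J.card - m) *
      (J.card.choose m : ℝ[X])).coeff t = if t = m then (4 / 3 : ℝ) ^ m * (1 / 3) ^ (J.card - m) * (J.card.choose m) else 0 := by
    intro m _
    rw [mul_pow, ← Polynomial.C_pow, ← Polynomial.C_pow, show (J.card.choose m : ℝ[X]) = Polynomial.C ((J.card.choose m : ℕ) : ℝ) by simp,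
      show Polynomial.C ((4 / 3 : ℝ) ^ m) * X ^ m * Polynomial.C ((1 / 3 : ℝ) ^ (J.card - m)) * Polynomial.C ((J.card.choose m : ℕ) : ℝ)
        = Polynomial.C ((4 / 3 : ℝ) ^ m * (1 / 3) ^ (J.card - m) * (J.card.choose m)) * X ^ m by
          rw [Polynomial.C_mul, Polynomial.C_mul]; ring,
      coeff_C_mul_X_pow]
  rw [sum_congr rfl hcoef, sum_ite_eq]
  by_cases ht : t ∈ range (J.card + 1)
  · rw [if_pos ht]
    have htle : t ≤ J.card := by rw [mem_range] at ht; omega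
    rw [show (3 : ℝ)⁻¹ ^ J.card = (1 / 3 : ℝ) ^ (J.card - t) * (1 / 3) ^ t by
      rw [← pow_add, Nat.sub_add_cancel htle, one_div]]
    rw [show ((4 : ℝ) / 3) ^ t = 4 ^ t * (1 / 3) ^ t by rw [div_eq_mul_one_div, mul_pow]]
    ring
  · rw [if_neg ht]
    have hgt : J.card < t := by rw [mem_range] at ht; omega
    rw [Nat.choose_eq_zero_of_lt hgt]; simp

omit [Fintype ι] [DecidableEq ι] in
/-- **The short `L¹` mass is `S(|J|, s₀)`**: `Σ_{wt s ≤ s₀} ∏_k ‖a_{k,s_k}‖ = 3^{−|J|} Σ_{t ≤ s₀} C(|J|,t) 4^t`. -/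
theorem sum_short_eq_shortMass (A : κ → Finset (ZMod 3)) (J : Finset κ) (hgen : ∀ k ∈ J, (A k).Nonempty ∧ A k ≠ univ)
    (htriv : ∀ k, k ∉ J → ¬ ((A k).Nonempty ∧ A k ≠ univ)) (s₀ : ℕ) :
    ∑ s ∈ (univ : Finset (κ → ZMod 3)).filter (fun s => wt s ≤ s₀), ∏ k, ‖fcoef (signTest (A k)) (s k)‖ =
      (3 : ℝ)⁻¹ ^ J.card * ∑ t ∈ range (s₀ + 1), ((J.card.choose t : ℕ) : ℝ) * 4 ^ t := by
  classical
  rw [mul_sum, ← sum_congr rfl fun t _ => sum_wt_eq A J hgen htriv t, sum_fiberwise_eq_sum_filter]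
  congr 1
  ext s
  simp only [mem_filter, mem_univ, true_and, mem_range]
  omega

/-! ### The mixed-norm count -/

/-- **The bound on the twisted sums under (NH_{s₀}) (Lemma 38.C).**  Genuine tests exactly on `J`, trivial elsewhere;
`S(|J|,s₀) ≤ 1/10` and the long `3/4`-mass `≤ 1/100`: `‖Σ_u (−1)^{#fire(u)} χ₂(t)^{|u|}‖ ≤ 2^{|ι|}/5`. -/
theorem norm_twisted_sum_le_mixed (δ : κ → ι → ZMod 3) (A : κ → Finset (ZMod 3)) (J : Finset κ)
    (hgen : ∀ k ∈ J, (A k).Nonempty ∧ A k ≠ univ) (htriv : ∀ k, k ∉ J → ¬ ((A k).Nonempty ∧ A k ≠ univ))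
    (s₀ : ℕ) (hshort : (3 : ℝ)⁻¹ ^ J.card * ∑ t ∈ range (s₀ + 1), ((J.card.choose t : ℕ) : ℝ) * 4 ^ t ≤ 1 / 10)
    (hlong : ∑ s ∈ univ.filter (fun s : κ → ZMod 3 => s₀ < wt s ∧ ∀ k, k ∉ J → s k = 0),
      ((3 : ℝ) / 4) ^ wt (combo δ s) ≤ 1 / 100)
    (t : ZMod 2) :
    ‖∑ u : ι → Bool, (-1 : ℂ) ^ (univ.filter fun k => subsetSum (δ k) u ∈ A k).card *
        (stdAddChar t : ℂ) ^ (univ.filter fun i => u i = true).card‖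
      ≤ (2 : ℝ) ^ Fintype.card ι * (1 / 5) := by
  classical
  set a : κ → ZMod 3 → ℂ := fun k => fcoef (signTest (A k)) with ha
  have hmain := norm_sum_prod_twist_le δ a (fun k => signTest (A k)) (fun k v => fourier_inversion _ v) t
  simp_rw [prod_signTest_eq] at hmain
  refine hmain.trans ?_
  set c : (κ → ZMod 3) → ℝ := fun s => ∏ k, ‖a k (s k)‖ with hc
  have hc_nonneg : ∀ s, 0 ≤ c s := fun s => prod_nonneg fun k _ => norm_nonneg _
  -- patterns touching a trivial test contribute nothing
  have hc_zero : ∀ s : κ → ZMod 3, (∃ k, k ∉ J ∧ s k ≠ 0) → c s = 0 := by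
    rintro s ⟨k, hkJ, hsk⟩
    refine prod_eq_zero (mem_univ k) ?_
    rw [ha]; dsimp only
    obtain ⟨c', -, hA⟩ := signTest_const_of (htriv k hkJ)
    rw [hA, fcoef_const, if_neg hsk, norm_zero]
  -- Parseval over all patterns
  have hpars : ∑ s : κ → ZMod 3, c s ^ 2 = 1 := by
    have e : ∀ s : κ → ZMod 3, c s ^ 2 = ∏ k, ‖a k (s k)‖ ^ 2 := fun s => by rw [hc]; dsimp only; rw [prod_pow]
    simp_rw [e]
    rw [← Fintype.prod_sum (fun k tk => ‖a k tk‖ ^ 2)]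
    exact prod_eq_one fun k _ => sum_norm_sq_fcoef_signTest (A k)
  -- every pattern term is at most `2^n c_s`, and long ones at most `2^n c_s (√3/2)^{wt λ(s)}`
  set Sshort : Finset (κ → ZMod 3) := univ.filter fun s => wt s ≤ s₀ with hSshort
  set Slong : Finset (κ → ZMod 3) := univ.filter (fun s : κ → ZMod 3 => s₀ < wt s ∧ ∀ k, k ∉ J → s k = 0) with hSlong
  have hsplit : ∑ s : κ → ZMod 3, c s * ∏ i, ‖(1 : ℂ) + stdAddChar (combo δ s i) * stdAddChar t‖
      ≤ ∑ s ∈ Sshort, c s * (2 : ℝ) ^ Fintype.card ι +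
        ∑ s ∈ Slong, c s * ((2 : ℝ) ^ Fintype.card ι * (Real.sqrt 3 / 2) ^ wt (combo δ s)) := by
    have hcover : ∀ s : κ → ZMod 3, c s * ∏ i, ‖(1 : ℂ) + stdAddChar (combo δ s i) * stdAddChar t‖ ≤
        (if s ∈ Sshort then c s * (2 : ℝ) ^ Fintype.card ι else 0) +
          (if s ∈ Slong then c s * ((2 : ℝ) ^ Fintype.card ι * (Real.sqrt 3 / 2) ^ wt (combo δ s)) else 0) := by
      intro s
      have hP := prod_norm_twist_le (combo δ s) t
      have hP2 : ∏ i, ‖(1 : ℂ) + stdAddChar (combo δ s i) * stdAddChar t‖ ≤ (2 : ℝ) ^ Fintype.card ι :=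
        hP.trans (mul_le_of_le_one_right (by positivity) (pow_le_one₀ (by positivity)
          (by rw [div_le_one (by norm_num : (0:ℝ) < 2)]
              have h4 : Real.sqrt 3 ≤ Real.sqrt 4 := Real.sqrt_le_sqrt (by norm_num)
              have h2 : Real.sqrt 4 = 2 := by
                rw [show (4 : ℝ) = 2 ^ 2 by norm_num, Real.sqrt_sq (by norm_num : (0 : ℝ) ≤ 2)]
              linarith)))
      by_cases hs : wt s ≤ s₀
      · have hsS : s ∈ Sshort := mem_filter.2 ⟨mem_univ _, hs⟩
        have hsL : s ∉ Slong := fun h => by have := (mem_filter.1 h).2.1; omega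
        rw [if_pos hsS, if_neg hsL, add_zero]
        exact mul_le_mul_of_nonneg_left hP2 (hc_nonneg s)
      · have hsS : s ∉ Sshort := fun h => hs (mem_filter.1 h).2
        rw [if_neg hsS]
        by_cases hJ : ∀ k, k ∉ J → s k = 0
        · have hsL : s ∈ Slong := mem_filter.2 ⟨mem_univ _, by omega, hJ⟩
          rw [if_pos hsL, zero_add]
          exact mul_le_mul_of_nonneg_left hP (hc_nonneg s)
        · have hsL : s ∉ Slong := fun h => hJ (mem_filter.1 h).2.2
          rw [if_neg hsL, zero_add]
          push Not at hJ
          obtain ⟨k, hk, hsk⟩ := hJ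
          rw [hc_zero s ⟨k, hk, hsk⟩, zero_mul]
    refine (sum_le_sum fun s _ => hcover s).trans ?_
    rw [sum_add_distrib, ← sum_filter, ← sum_filter]
    simp only [filter_mem_eq_inter, univ_inter]
    rfl
  -- short part: `L¹` mass
  have hS : ∑ s ∈ Sshort, c s * (2 : ℝ) ^ Fintype.card ι ≤ (2 : ℝ) ^ Fintype.card ι * (1 / 10) := by
    rw [← sum_mul, mul_comm]
    refine mul_le_mul_of_nonneg_left ?_ (by positivity)
    rw [hSshort, hc]
    exact le_of_eq_of_le (sum_short_eq_shortMass A J hgen htriv s₀) hshort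
  -- long part: Cauchy–Schwarz
  have hL : ∑ s ∈ Slong, c s * ((2 : ℝ) ^ Fintype.card ι * (Real.sqrt 3 / 2) ^ wt (combo δ s))
      ≤ (2 : ℝ) ^ Fintype.card ι * (1 / 10) := by
    have e : ∑ s ∈ Slong, c s * ((2 : ℝ) ^ Fintype.card ι * (Real.sqrt 3 / 2) ^ wt (combo δ s)) =
        (2 : ℝ) ^ Fintype.card ι * ∑ s ∈ Slong, c s * (Real.sqrt 3 / 2) ^ wt (combo δ s) := by
      rw [mul_sum]; exact sum_congr rfl fun s _ => by ring
    rw [e]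
    refine mul_le_mul_of_nonneg_left ?_ (by positivity)
    set X : ℝ := ∑ s ∈ Slong, c s * (Real.sqrt 3 / 2) ^ wt (combo δ s) with hX
    have hX_nonneg : 0 ≤ X := sum_nonneg fun s _ => mul_nonneg (hc_nonneg s) (by positivity)
    have hcs := sum_mul_sq_le_sq_mul_sq Slong c (fun s => (Real.sqrt 3 / 2) ^ wt (combo δ s))
    have h1 : ∑ s ∈ Slong, c s ^ 2 ≤ 1 := by
      rw [← hpars]; exact sum_le_sum_of_subset_of_nonneg (filter_subset _ _) fun s _ _ => sq_nonneg _
    have h2 : ∑ s ∈ Slong, ((Real.sqrt 3 / 2) ^ wt (combo δ s)) ^ 2 ≤ 1 / 100 := by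
      refine le_trans (le_of_eq (sum_congr rfl fun s _ => ?_)) hlong
      rw [← pow_mul, mul_comm, pow_mul, div_pow, Real.sq_sqrt (by norm_num : (0 : ℝ) ≤ 3)]
      norm_num
    have hsq : X ^ 2 ≤ 1 * (1 / 100) :=
      hcs.trans (mul_le_mul h1 h2 (sum_nonneg fun s _ => sq_nonneg _) (by norm_num))
    nlinarith [hX_nonneg, hsq]
  calc ∑ s : κ → ZMod 3, (∏ k, ‖a k (s k)‖) * ∏ i, ‖(1 : ℂ) + stdAddChar (combo δ s i) * stdAddChar t‖
      = ∑ s : κ → ZMod 3, c s * ∏ i, ‖(1 : ℂ) + stdAddChar (combo δ s i) * stdAddChar t‖ := rfl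
    _ ≤ _ := hsplit
    _ ≤ (2 : ℝ) ^ Fintype.card ι * (1 / 10) + (2 : ℝ) ^ Fintype.card ι * (1 / 10) := add_le_add hS hL
    _ = (2 : ℝ) ^ Fintype.card ι * (1 / 5) := by ring

/-- **Lemma 38.C, counting form (the parity-class count under (NH_{s₀})).**  Genuine tests exactly on `J`, trivial elsewhere,
short mass `S(|J|,s₀) ≤ 1/10`, long `3/4`-mass `≤ 1/100`: on `{u : |u| ≡ p}` the number of firing tests has parity `c` for at most
`(7/8)·2^{|ι|−1}` points (indeed `≤ (3/5)·2^{|ι|−1}`). -/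
theorem card_parityClass_filter_le_mixed (δ : κ → ι → ZMod 3) (A : κ → Finset (ZMod 3)) (J : Finset κ)
    (hgen : ∀ k ∈ J, (A k).Nonempty ∧ A k ≠ univ) (htriv : ∀ k, k ∉ J → ¬ ((A k).Nonempty ∧ A k ≠ univ))
    (hι : 0 < Fintype.card ι) (s₀ : ℕ)
    (hshort : (3 : ℝ)⁻¹ ^ J.card * ∑ t ∈ range (s₀ + 1), ((J.card.choose t : ℕ) : ℝ) * 4 ^ t ≤ 1 / 10)
    (hlong : ∑ s ∈ univ.filter (fun s : κ → ZMod 3 => s₀ < wt s ∧ ∀ k, k ∉ J → s k = 0),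
      ((3 : ℝ) / 4) ^ wt (combo δ s) ≤ 1 / 100)
    (p c : ℕ) :
    ((univ.filter fun u : ι → Bool =>
        (univ.filter fun i => u i = true).card % 2 = p % 2 ∧
        (univ.filter fun k => subsetSum (δ k) u ∈ A k).card % 2 = c % 2).card : ℝ)
      ≤ 7 / 8 * (2 : ℝ) ^ (Fintype.card ι - 1) := by
  classical
  set wtu : (ι → Bool) → ℕ := fun u => (univ.filter fun i => u i = true).card with hwtu
  set N : (ι → Bool) → ℕ := fun u => (univ.filter fun k => subsetSum (δ k) u ∈ A k).card with hN
  set E : Finset (ι → Bool) := univ.filter fun u => wtu u % 2 = p % 2 with hE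
  set R : ℝ := ∑ u ∈ E, (-1 : ℝ) ^ N u with hR
  have hT := fun t => norm_twisted_sum_le_mixed δ A J hgen htriv s₀ hshort hlong t
  have hRC : ((R : ℝ) : ℂ) = ∑ u ∈ E, (-1 : ℂ) ^ N u := by
    rw [hR]; push_cast; rfl
  have hRid : (∑ u : ι → Bool, (-1 : ℂ) ^ N u * (stdAddChar (0 : ZMod 2) : ℂ) ^ wtu u) +
      (-1 : ℂ) ^ p * (∑ u : ι → Bool, (-1 : ℂ) ^ N u * (stdAddChar (1 : ZMod 2) : ℂ) ^ wtu u) =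
      2 * ∑ u ∈ E, (-1 : ℂ) ^ N u := by
    rw [AddChar.map_zero_eq_one, stdAddChar_two_one, mul_sum, ← sum_add_distrib,
      ← sum_filter_add_sum_filter_not univ (fun u : ι → Bool => wtu u % 2 = p % 2)]
    have hon : ∀ u ∈ univ.filter (fun u : ι → Bool => wtu u % 2 = p % 2),
        (-1 : ℂ) ^ N u * (1 : ℂ) ^ wtu u + (-1 : ℂ) ^ p * ((-1 : ℂ) ^ N u * (-1 : ℂ) ^ wtu u) =
          2 * (-1 : ℂ) ^ N u := by
      intro u hu
      have h := (mem_filter.1 hu).2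
      have hsgn := neg_one_pow_mul_neg_one_pow p (wtu u)
      rw [if_pos (by omega)] at hsgn
      have hsgnC : ((-1 : ℂ) ^ p) * (-1) ^ wtu u = 1 := by exact_mod_cast hsgn
      rw [one_pow]
      linear_combination ((-1 : ℂ) ^ N u) * hsgnC
    have hoff : ∀ u ∈ univ.filter (fun u : ι → Bool => ¬ wtu u % 2 = p % 2),
        (-1 : ℂ) ^ N u * (1 : ℂ) ^ wtu u + (-1 : ℂ) ^ p * ((-1 : ℂ) ^ N u * (-1 : ℂ) ^ wtu u) = 0 := by
      intro u hu
      have h := (mem_filter.1 hu).2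
      have hsgn := neg_one_pow_mul_neg_one_pow p (wtu u)
      rw [if_neg (by omega)] at hsgn
      have hsgnC : ((-1 : ℂ) ^ p) * (-1) ^ wtu u = -1 := by exact_mod_cast hsgn
      rw [one_pow]
      linear_combination ((-1 : ℂ) ^ N u) * hsgnC
    rw [sum_congr rfl hon, sum_congr rfl hoff, sum_const_zero, add_zero, ← mul_sum]
  have hRabs : 2 * |R| ≤ (2 : ℝ) ^ Fintype.card ι * (2 / 5) := by
    have h : ‖(2 : ℂ) * ((R : ℝ) : ℂ)‖ = ‖(∑ u : ι → Bool, (-1 : ℂ) ^ N u * (stdAddChar (0 : ZMod 2) : ℂ) ^ wtu u) +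
        (-1 : ℂ) ^ p * (∑ u : ι → Bool, (-1 : ℂ) ^ N u * (stdAddChar (1 : ZMod 2) : ℂ) ^ wtu u)‖ := by
      rw [hRid, hRC]
    rw [norm_mul, Complex.norm_real, Real.norm_eq_abs] at h
    have h2 : ‖(2 : ℂ)‖ = 2 := by simp
    rw [h2] at h
    rw [h]
    refine (norm_add_le _ _).trans ?_
    rw [norm_mul]
    have hp1 : ‖(-1 : ℂ) ^ p‖ = 1 := by simp
    rw [hp1, one_mul]
    have h0 := hT 0
    have h1 := hT 1
    linarith
  have hEcard : (E.card : ℝ) = (2 : ℝ) ^ (Fintype.card ι - 1) := card_parityClass hι p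
  have hsplit := card_filter_add_card_filter_not (s := E) (fun u => N u % 2 = 0)
  have hpos : ∀ u ∈ E.filter (fun u => N u % 2 = 0), (-1 : ℝ) ^ N u = 1 :=
    fun u hu => (Nat.even_iff.2 (mem_filter.1 hu).2).neg_one_pow
  have hneg : ∀ u ∈ E.filter (fun u => ¬ N u % 2 = 0), (-1 : ℝ) ^ N u = -1 :=
    fun u hu => (Nat.odd_iff.2 (by have := (mem_filter.1 hu).2; omega)).neg_one_pow
  have hRsplit : R = ((E.filter fun u => N u % 2 = 0).card : ℝ) - ((E.filter fun u => ¬ N u % 2 = 0).card : ℝ) := by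
    rw [hR, ← sum_filter_add_sum_filter_not E (fun u => N u % 2 = 0), sum_congr rfl hpos, sum_congr rfl hneg]
    simp [sub_eq_add_neg]
  have hpow : (2 : ℝ) ^ Fintype.card ι = 2 * (2 : ℝ) ^ (Fintype.card ι - 1) := by
    rw [← pow_succ']; congr 1; omega
  have htarget : (univ.filter fun u : ι → Bool => wtu u % 2 = p % 2 ∧ N u % 2 = c % 2) =
      E.filter fun u => N u % 2 = c % 2 := by
    rw [hE, filter_filter]
  rw [htarget]
  have hsplitR : ((E.filter fun u => N u % 2 = 0).card : ℝ) + ((E.filter fun u => ¬ N u % 2 = 0).card : ℝ)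
      = E.card := by exact_mod_cast hsplit
  rcases Nat.mod_two_eq_zero_or_one c with hc | hc
  · rw [hc]
    have habs := le_abs_self R
    linarith
  · rw [hc]
    have e : (E.filter fun u => N u % 2 = 1) = E.filter fun u => ¬ N u % 2 = 0 :=
      filter_congr fun u _ => by omega
    rw [e]
    have habs := neg_abs_le R
    linarith

end Mixed

end Summit.QuantumAdvantage.AdviceFreeQNC0.Exp37

end
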